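import Summits.Ventures.YMGap.RobustBall.TorusRowsSU2StarW3
import HarnessLib

/-!
# Venture YMGap, track ROBUST-BALL (Y2) — crux Y2-X2-W, step W8: HYPOTHESIS-FREE `SU(N)` / `SU(3)` ROWS of the robust
# vertex-star door on the TIER-2 (weighted, infinite-range) torus ball, on p2's one-link EIGEN modulus

HONEST FRAMING. WHAT THIS IS: a venture file (cell `pub-ymgap`, track Y2 ROBUST-BALL, seat ds-2): the weighted twin of
`TorusRowsSU3Star` — generic-`N` schemas (`N ≥ 2`) feeding `RobustStarDoorW` with the tree's hypothesis-free eigen modulus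
`OneLinkEigen.oneLinkKRModulus_eigen` (`K_N(R) = N²/(N²−1)·(1/2 + 2R)/(1/2 − R)` on the radius `R = 6β_W/N²` for `d = 4`,
`4β_W/N²` for `d = 3`, `R < 1/2`), robust coefficient `c ≥ K_N e^{2ε}(1 + 2√N ε)β_W/N²`, `λ ≥ √N ε`, weighted door
`T₁·(R_G^{(d)}(c) + (T₂λ + θ^{20}·4d·T₂λ)/(1−θ)) < 1`; every row an exact-rational certificate checked by `norm_num`.
`SU(3)` ROWS (β_W, ε), HYPOTHESIS-FREE, class K: `d = 4` (`TorusClusteringOnBallW 3 4 β κ (2ε) ε (24e^{2t}) t`, `0 ≤ β ≤ β_W/3`):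
at `t = 1/100` for every `κ ≥ 1/100`: (1/8, .146) (1/6, .102) (1/5, .068) (1/4, .018); at `κ = t = log(6/5)`: (1/8, .110);
`d = 3` (Y4's `ClusterDomainClustering` on the weighted ball): `t = 1/100`: (1/4, .104) (1/3, .049); `log(6/5)`:
(3/10, .049). WHAT THIS IS NOT: radii and rates are door artefacts; torus currency; nothing about `SU(3)` beyond the eigen
modulus' window `R < 1/2`; nothing about the continuum limit or the Millennium problem.

## References
* The tree: `RobustStarDoorW.lean`, `TorusRowsSU2StarW(3).lean` (this seat), `TorusRowsSU3Star.lean` (g7 eigen schemas),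
  `Thresholds/OneLinkEigenModulus.lean` (p2).
-/

noncomputable section

open Finset
open Literature.MathematicalPhysics.QuantumLattice (fundamentalRep)
open Literature.MathematicalPhysics.QuantumFieldTheory hiding ZdEdge
open Literature.MathematicalPhysics.QuantumFieldTheory.Balaban1983to89.StrongCouplingTorusWindow
open Literature.MathematicalPhysics.QuantumFieldTheory.Balaban1983to89.StrongCouplingDobrushinWindow
  (OneLinkKRModulus OneLinkKRModulusSU2)
open Summit.Ventures.YMGap.StarResolventDim (Delta gaugeR doorPoly Delta_pos_of_door gaugeR_lt_one_of_door)

namespace Summit.Ventures.YMGap.RobustBall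

/-! ### Certified decimal majorants -/

/-- `e^{51 / 250} ≤ 1226299 / 1000000` (Mathlib's `Real.exp_bound'`, five terms). [folklore] -/
theorem exp_le_51_250_w8 : Real.exp (51 / 250) ≤ 1226299 / 1000000 := by
  have h := Real.exp_bound' (x := 51 / 250) (by norm_num) (by norm_num) (n := 5) (by norm_num)
  refine h.trans ?_
  simp only [Finset.sum_range_succ, Finset.sum_range_zero, Nat.factorial]
  norm_num

/-- `e^{9 / 250} ≤ 64791 / 62500` (Mathlib's `Real.exp_bound'`, five terms). [folklore] -/
theorem exp_le_9_250_w8 : Real.exp (9 / 250) ≤ 64791 / 62500 := by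
  have h := Real.exp_bound' (x := 9 / 250) (by norm_num) (by norm_num) (n := 5) (by norm_num)
  refine h.trans ?_
  simp only [Finset.sum_range_succ, Finset.sum_range_zero, Nat.factorial]
  norm_num

/-! ### The schemas: `SU(N)` on the eigen modulus through the weighted robust star door -/

/-- `2(2√N)² e^{2t} = 8N e^{2t}`. [folklore] -/
theorem two_mul_sq_two_sqrt_nat (N : ℕ) (t : ℝ) :
    2 * (2 * Real.sqrt (N : ℝ)) ^ 2 * Real.exp (2 * t) = 8 * N * Real.exp (2 * t) := by
  rw [mul_pow, Real.sq_sqrt (Nat.cast_nonneg N)]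
  ring

/-- **SCHEMA, `SU(N)` (`N ≥ 2`), `d = 4`, HYPOTHESIS-FREE, TIER 2**: torus clustering on the weighted ball
`ClusterDomain κ ε₀ ε₁` at rate `t` (`0 ≤ t ≤ κ`) with constant `8N e^{2t}`, uniformly in `L ≥ 3` and in `0 ≤ β ≤ β_W/N`,
through the WEIGHTED ROBUST STAR DOOR on p2's eigen modulus at radius `R = 6β_W/N² < 1/2`. [folklore] -/
theorem suN_torusClusteringOnBallW_star_eigen (Kn : ℕ) {N : ℕ} (hN : 2 ≤ N) {βW κ ε₀ ε₁ c lam E S Kb t T₁ T₂ : ℝ}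
    (hβ0 : 0 < βW) (hR : βW / (N : ℝ) ^ 2 * 6 < 1 / 2) (hε₁ : 0 ≤ ε₁) (ht : 0 ≤ t) (htκ : t ≤ κ)
    (hE : Real.exp ε₀ ≤ E) (hS : Real.sqrt N ≤ S) (hT₁ : Real.exp t ≤ T₁) (hT₂ : Real.exp (2 * t) ≤ T₂)
    (hKb : (N : ℝ) ^ 2 / ((N : ℝ) ^ 2 - 1) * ((1 / 2 + 2 * (βW / (N : ℝ) ^ 2 * 6)) /
      (1 / 2 - βW / (N : ℝ) ^ 2 * 6)) ≤ Kb)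
    (hc : Kb * E * (1 + 2 * S * ε₁) * (βW / (N : ℝ) ^ 2) ≤ c) (hlam : S * ε₁ ≤ lam) (hθ1 : 6 * c + lam < 1)
    (hcd : doorPoly 4 c < 1)
    (hρ1 : T₁ * (gaugeR 4 c + (T₂ * lam + (6 * c + lam) ^ Kn * (16 * (T₂ * lam))) / (1 - (6 * c + lam))) < 1) :
    ∀ β : ℝ, 0 ≤ β → β ≤ βW / N → TorusClusteringOnBallW N 4 β κ ε₀ ε₁ (8 * N * Real.exp (2 * t)) t := by
  have hN1 : 1 ≤ N := by omega
  have hNpos : (0 : ℝ) < N := by exact_mod_cast (show 0 < N by omega)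
  have hN2 : (2 : ℝ) ≤ N := by exact_mod_cast hN
  set R : ℝ := βW / (N : ℝ) ^ 2 * 6 with hRdef
  have hR0 : 0 ≤ R := by positivity
  set K : ℝ := (N : ℝ) ^ 2 / ((N : ℝ) ^ 2 - 1) * ((1 / 2 + 2 * R) / (1 / 2 - R)) with hKdef
  have hmod : OneLinkKRModulus N R K := OneLinkEigen.oneLinkKRModulus_eigen hN hR
  have hK0 : 0 ≤ K := by
    have h1 : (0 : ℝ) < (N : ℝ) ^ 2 - 1 := by nlinarith
    have h2 : (0 : ℝ) < 1 / 2 - R := by linarith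
    positivity
  have hS0 : 0 ≤ S := (Real.sqrt_nonneg _).trans hS
  have hE0 : 0 ≤ E := (Real.exp_pos _).le.trans hE
  have hKb0 : 0 ≤ Kb := hK0.trans hKb
  have hc0 : 0 ≤ c := le_trans (by positivity) hc
  have hlam0 : 0 ≤ lam := le_trans (by positivity) hlam
  set θ : ℝ := 6 * c + lam with hθ
  set ρ : ℝ := Real.exp t * (gaugeR 4 c +
    (Real.exp (2 * t) * lam + θ ^ Kn * (16 * (Real.exp (2 * t) * lam))) / (1 - θ)) with hρ
  have hθ0 : 0 ≤ θ := by positivity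
  have h1θ : 0 < 1 - θ := by linarith
  have hgR := gaugeR_lt_one_of_door (d := 4) (by norm_num) hc0 hcd
  have hθK : 0 ≤ θ ^ Kn := pow_nonneg hθ0 Kn
  have hin0 : 0 ≤ gaugeR 4 c + (Real.exp (2 * t) * lam + θ ^ Kn * (16 * (Real.exp (2 * t) * lam))) / (1 - θ) :=
    add_nonneg hgR.1 (div_nonneg (by positivity) h1θ.le)
  have hin : gaugeR 4 c + (Real.exp (2 * t) * lam + θ ^ Kn * (16 * (Real.exp (2 * t) * lam))) / (1 - θ) ≤
      gaugeR 4 c + (T₂ * lam + θ ^ Kn * (16 * (T₂ * lam))) / (1 - θ) := by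
    have h1 : Real.exp (2 * t) * lam ≤ T₂ * lam := mul_le_mul_of_nonneg_right hT₂ hlam0
    have h2 : θ ^ Kn * (16 * (Real.exp (2 * t) * lam)) ≤ θ ^ Kn * (16 * (T₂ * lam)) :=
      mul_le_mul_of_nonneg_left (by linarith) hθK
    exact add_le_add le_rfl (div_le_div_of_nonneg_right (add_le_add h1 h2) h1θ.le)
  have hρ1' : ρ < 1 :=
    calc ρ ≤ T₁ * (gaugeR 4 c + (T₂ * lam + θ ^ Kn * (16 * (T₂ * lam))) / (1 - θ)) :=
          mul_le_mul hT₁ hin hin0 ((Real.exp_pos _).le.trans hT₁)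
      _ < 1 := hρ1
  have hβN : βW / (N : ℝ) / (N : ℝ) = βW / (N : ℝ) ^ 2 := by rw [div_div, sq]
  have hR' : βW / (N : ℝ) / (N : ℝ) * (2 * (((4 : ℕ) : ℝ) - 1)) ≤ R := by rw [hβN, hRdef]; norm_num
  have hc' : K * Real.exp ε₀ * (1 + 2 * Real.sqrt N * ε₁) * (βW / (N : ℝ) / (N : ℝ)) ≤ c := by
    refine le_trans ?_ hc
    rw [hβN]
    have hb : 0 ≤ βW / (N : ℝ) ^ 2 := by positivity
    have h2 : 1 + 2 * Real.sqrt N * ε₁ ≤ 1 + 2 * S * ε₁ := by nlinarith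
    have h3 : 0 ≤ 1 + 2 * Real.sqrt N * ε₁ := by positivity
    calc K * Real.exp ε₀ * (1 + 2 * Real.sqrt N * ε₁) * (βW / (N : ℝ) ^ 2)
        ≤ Kb * E * (1 + 2 * Real.sqrt N * ε₁) * (βW / (N : ℝ) ^ 2) := by gcongr
      _ ≤ Kb * E * (1 + 2 * S * ε₁) * (βW / (N : ℝ) ^ 2) := by gcongr
  have hlam' : Real.sqrt N * ε₁ ≤ lam := le_trans (mul_le_mul_of_nonneg_right hS hε₁) hlam
  have hθ' : θ = (2 * ((4 : ℕ) : ℝ) - 2) * c + lam := by rw [hθ]; push_cast; ring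
  have hρ' : ρ = Real.exp t * (gaugeR 4 c +
      (Real.exp (2 * t) * lam + θ ^ Kn * (4 * ((4 : ℕ) : ℝ) * (Real.exp (2 * t) * lam))) / (1 - θ)) := by
    rw [hρ]; push_cast; ring
  have h := torusClusteringOnBallW_upTo_of_robustStar (d := 4) (N := N) (by norm_num) hN1 Kn hK0 hR' hmod hε₁ ht htκ
    hc' hlam' hθ' hθ1 hcd hρ' hρ1'
  rw [two_mul_sq_two_sqrt_nat] at h
  exact h

/-- **SCHEMA, `SU(N)` (`N ≥ 2`), `d = 3`, HYPOTHESIS-FREE, TIER 2**: Y4's `YM3IR.ClusterDomainClustering` on the weighted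
ball `ClusterDomain κ ε₀ ε₁` up to `β_W/N` at rate `t`, through the weighted robust star door on the eigen modulus at radius
`R = 4β_W/N² < 1/2` (door `8c² + 6c < 1`, `θ = 4c + λ`), plus the torus form. [folklore] -/
theorem suN_clusterDomainClusteringW_dim3_star_eigen (Kn : ℕ) {N : ℕ} (hN : 2 ≤ N)
    {βW κ ε₀ ε₁ c lam E S Kb t T₁ T₂ : ℝ} (hβ0 : 0 < βW) (hR : βW / (N : ℝ) ^ 2 * 4 < 1 / 2) (hε₁ : 0 ≤ ε₁)
    (ht : 0 ≤ t) (htκ : t ≤ κ) (hE : Real.exp ε₀ ≤ E) (hS : Real.sqrt N ≤ S) (hT₁ : Real.exp t ≤ T₁)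
    (hT₂ : Real.exp (2 * t) ≤ T₂)
    (hKb : (N : ℝ) ^ 2 / ((N : ℝ) ^ 2 - 1) * ((1 / 2 + 2 * (βW / (N : ℝ) ^ 2 * 4)) /
      (1 / 2 - βW / (N : ℝ) ^ 2 * 4)) ≤ Kb)
    (hc : Kb * E * (1 + 2 * S * ε₁) * (βW / (N : ℝ) ^ 2) ≤ c) (hlam : S * ε₁ ≤ lam) (hθ1 : 4 * c + lam < 1)
    (hcd : doorPoly 3 c < 1)
    (hρ1 : T₁ * (gaugeR 3 c + (T₂ * lam + (4 * c + lam) ^ Kn * (12 * (T₂ * lam))) / (1 - (4 * c + lam))) < 1) :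
    YM3IR.ClusterDomainClustering (G := SUN N)
        ⟨fundamentalRep (Fin N), βW / N, fun _ _ W => W ∈ ClusterDomain κ ε₀ ε₁⟩ suFrobDist t ∧
      ∀ β : ℝ, 0 ≤ β → β ≤ βW / N → TorusClusteringOnBallW N 3 β κ ε₀ ε₁ (8 * N * Real.exp (2 * t)) t := by
  have hN1 : 1 ≤ N := by omega
  have hNpos : (0 : ℝ) < N := by exact_mod_cast (show 0 < N by omega)
  have hN2 : (2 : ℝ) ≤ N := by exact_mod_cast hN
  set R : ℝ := βW / (N : ℝ) ^ 2 * 4 with hRdef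
  have hR0 : 0 ≤ R := by positivity
  set K : ℝ := (N : ℝ) ^ 2 / ((N : ℝ) ^ 2 - 1) * ((1 / 2 + 2 * R) / (1 / 2 - R)) with hKdef
  have hmod : OneLinkKRModulus N R K := OneLinkEigen.oneLinkKRModulus_eigen hN hR
  have hK0 : 0 ≤ K := by
    have h1 : (0 : ℝ) < (N : ℝ) ^ 2 - 1 := by nlinarith
    have h2 : (0 : ℝ) < 1 / 2 - R := by linarith
    positivity
  have hS0 : 0 ≤ S := (Real.sqrt_nonneg _).trans hS
  have hE0 : 0 ≤ E := (Real.exp_pos _).le.trans hE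
  have hKb0 : 0 ≤ Kb := hK0.trans hKb
  have hc0 : 0 ≤ c := le_trans (by positivity) hc
  have hlam0 : 0 ≤ lam := le_trans (by positivity) hlam
  set θ : ℝ := 4 * c + lam with hθ
  set ρ : ℝ := Real.exp t * (gaugeR 3 c +
    (Real.exp (2 * t) * lam + θ ^ Kn * (12 * (Real.exp (2 * t) * lam))) / (1 - θ)) with hρ
  have hθ0 : 0 ≤ θ := by positivity
  have h1θ : 0 < 1 - θ := by linarith
  have hgR := gaugeR_lt_one_of_door (d := 3) (by norm_num) hc0 hcd
  have hθK : 0 ≤ θ ^ Kn := pow_nonneg hθ0 Kn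
  have hin0 : 0 ≤ gaugeR 3 c + (Real.exp (2 * t) * lam + θ ^ Kn * (12 * (Real.exp (2 * t) * lam))) / (1 - θ) :=
    add_nonneg hgR.1 (div_nonneg (by positivity) h1θ.le)
  have hin : gaugeR 3 c + (Real.exp (2 * t) * lam + θ ^ Kn * (12 * (Real.exp (2 * t) * lam))) / (1 - θ) ≤
      gaugeR 3 c + (T₂ * lam + θ ^ Kn * (12 * (T₂ * lam))) / (1 - θ) := by
    have h1 : Real.exp (2 * t) * lam ≤ T₂ * lam := mul_le_mul_of_nonneg_right hT₂ hlam0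
    have h2 : θ ^ Kn * (12 * (Real.exp (2 * t) * lam)) ≤ θ ^ Kn * (12 * (T₂ * lam)) :=
      mul_le_mul_of_nonneg_left (by linarith) hθK
    exact add_le_add le_rfl (div_le_div_of_nonneg_right (add_le_add h1 h2) h1θ.le)
  have hρ1' : ρ < 1 :=
    calc ρ ≤ T₁ * (gaugeR 3 c + (T₂ * lam + θ ^ Kn * (12 * (T₂ * lam))) / (1 - θ)) :=
          mul_le_mul hT₁ hin hin0 ((Real.exp_pos _).le.trans hT₁)
      _ < 1 := hρ1
  have hβN : βW / (N : ℝ) / (N : ℝ) = βW / (N : ℝ) ^ 2 := by rw [div_div, sq]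
  have hR' : βW / (N : ℝ) / (N : ℝ) * 4 ≤ R := by rw [hβN, hRdef]
  have hR'' : βW / (N : ℝ) / (N : ℝ) * (2 * (((3 : ℕ) : ℝ) - 1)) ≤ R := by rw [hβN, hRdef]; norm_num
  have hc' : K * Real.exp ε₀ * (1 + 2 * Real.sqrt N * ε₁) * (βW / (N : ℝ) / (N : ℝ)) ≤ c := by
    refine le_trans ?_ hc
    rw [hβN]
    have hb : 0 ≤ βW / (N : ℝ) ^ 2 := by positivity
    have h2 : 1 + 2 * Real.sqrt N * ε₁ ≤ 1 + 2 * S * ε₁ := by nlinarith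
    have h3 : 0 ≤ 1 + 2 * Real.sqrt N * ε₁ := by positivity
    calc K * Real.exp ε₀ * (1 + 2 * Real.sqrt N * ε₁) * (βW / (N : ℝ) ^ 2)
        ≤ Kb * E * (1 + 2 * Real.sqrt N * ε₁) * (βW / (N : ℝ) ^ 2) := by gcongr
      _ ≤ Kb * E * (1 + 2 * S * ε₁) * (βW / (N : ℝ) ^ 2) := by gcongr
  have hlam' : Real.sqrt N * ε₁ ≤ lam := le_trans (mul_le_mul_of_nonneg_right hS hε₁) hlam
  have hθ' : θ = (2 * ((3 : ℕ) : ℝ) - 2) * c + lam := by rw [hθ]; push_cast; ring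
  have hρ' : ρ = Real.exp t * (gaugeR 3 c +
      (Real.exp (2 * t) * lam + θ ^ Kn * (4 * ((3 : ℕ) : ℝ) * (Real.exp (2 * t) * lam))) / (1 - θ)) := by
    rw [hρ]; push_cast; ring
  refine ⟨clusterDomainClusteringW_dim3_of_robustStar (N := N) hN1 Kn hK0 hR' hmod hε₁ ht htκ hc' hlam' hθ hθ1 hcd hρ
    hρ1', ?_⟩
  have h := torusClusteringOnBallW_upTo_of_robustStar (d := 3) (N := N) (by norm_num) hN1 Kn hK0 hR'' hmod hε₁ ht htκ
    hc' hlam' hθ' hθ1 hcd hρ' hρ1'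
  rw [two_mul_sq_two_sqrt_nat] at h
  exact h

/-! ### The `SU(3)` rows -/

/-- **TIER-2 ROW `(β_W, ε) = (1 / 8, 73 / 500)`, `SU(3)`, `d = 4` torus clustering on the weighted ball `ClusterDomain κ (73 / 250) (73 / 500)`,
WEIGHTED ROBUST STAR DOOR on the eigen modulus**, rate `1/100` per lattice unit, EVERY weight `κ ≥ 1/100`, tree couplings `0 ≤ β ≤ 1 / 24` (certificate:
`K_b = 9 / 5`, `c = 5041 / 100000`, `λ = 252881 / 1000000`, `ρ ≈ 0.9959`); HYPOTHESIS-FREE. [folklore] -/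
theorem su3_torusClusteringOnBallW_star_oneEighth_t100 :
    ∀ κ : ℝ, 1 / 100 ≤ κ → ∀ β : ℝ, 0 ≤ β → β ≤ 1 / 24 →
      TorusClusteringOnBallW 3 4 β κ (73 / 250) (73 / 500) (24 * Real.exp (1 / 50)) (1 / 100) := by
  intro κ hκ
  have e1 : (1 / 8 : ℝ) / ((3 : ℕ) : ℝ) = 1 / 24 := by norm_num
  have e3 : (8 : ℝ) * ((3 : ℕ) : ℝ) = 24 := by norm_num
  have h := suN_torusClusteringOnBallW_star_eigen 20 (N := 3) (by norm_num) (βW := 1 / 8) (κ := κ) (ε₀ := 73 / 250)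
    (ε₁ := 73 / 500) (c := 5041 / 100000) (lam := 252881 / 1000000) (S := 1.73206) (Kb := 9 / 5)
    (t := 1 / 100) (T₁ := 1010051 / 1000000) (T₂ := 510101 / 500000)
    (by norm_num) (by norm_num) (by norm_num) (by norm_num) hκ exp_le_73_250_w (by rw [show ((3 : ℕ) : ℝ) = 3 by norm_num]; exact sqrt_three_le)
    exp_le_1_100_w (by rw [show (2:ℝ) * (1 / 100) = 1 / 50 by norm_num]; exact exp_le_1_50_w)
    (by norm_num) (by norm_num) (by norm_num) (by norm_num) (by unfold doorPoly; norm_num)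
    (by unfold gaugeR Delta; norm_num)
  have e2 : (2 : ℝ) * (1 / 100) = 1 / 50 := by norm_num
  rw [e1, e2, e3] at h
  exact h

/-- **TIER-2 ROW `(β_W, ε) = (1 / 6, 51 / 500)`, `SU(3)`, `d = 4` torus clustering on the weighted ball `ClusterDomain κ (51 / 250) (51 / 500)`,
WEIGHTED ROBUST STAR DOOR on the eigen modulus**, rate `1/100` per lattice unit, EVERY weight `κ ≥ 1/100`, tree couplings `0 ≤ β ≤ 1 / 18` (certificate:
`K_b = 1044643 / 500000`, `c = 64211 / 1000000`, `λ = 176671 / 1000000`, `ρ ≈ 0.9921`); HYPOTHESIS-FREE. [folklore] -/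
theorem su3_torusClusteringOnBallW_star_oneSixth_t100 :
    ∀ κ : ℝ, 1 / 100 ≤ κ → ∀ β : ℝ, 0 ≤ β → β ≤ 1 / 18 →
      TorusClusteringOnBallW 3 4 β κ (51 / 250) (51 / 500) (24 * Real.exp (1 / 50)) (1 / 100) := by
  intro κ hκ
  have e1 : (1 / 6 : ℝ) / ((3 : ℕ) : ℝ) = 1 / 18 := by norm_num
  have e3 : (8 : ℝ) * ((3 : ℕ) : ℝ) = 24 := by norm_num
  have h := suN_torusClusteringOnBallW_star_eigen 20 (N := 3) (by norm_num) (βW := 1 / 6) (κ := κ) (ε₀ := 51 / 250)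
    (ε₁ := 51 / 500) (c := 64211 / 1000000) (lam := 176671 / 1000000) (S := 1.73206) (Kb := 1044643 / 500000)
    (t := 1 / 100) (T₁ := 1010051 / 1000000) (T₂ := 510101 / 500000)
    (by norm_num) (by norm_num) (by norm_num) (by norm_num) hκ exp_le_51_250_w8 (by rw [show ((3 : ℕ) : ℝ) = 3 by norm_num]; exact sqrt_three_le)
    exp_le_1_100_w (by rw [show (2:ℝ) * (1 / 100) = 1 / 50 by norm_num]; exact exp_le_1_50_w)
    (by norm_num) (by norm_num) (by norm_num) (by norm_num) (by unfold doorPoly; norm_num)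
    (by unfold gaugeR Delta; norm_num)
  have e2 : (2 : ℝ) * (1 / 100) = 1 / 50 := by norm_num
  rw [e1, e2, e3] at h
  exact h

/-- **TIER-2 ROW `(β_W, ε) = (1 / 5, 17 / 250)`, `SU(3)`, `d = 4` torus clustering on the weighted ball `ClusterDomain κ (17 / 125) (17 / 250)`,
WEIGHTED ROBUST STAR DOOR on the eigen modulus**, rate `1/100` per lattice unit, EVERY weight `κ ≥ 1/100`, tree couplings `0 ≤ β ≤ 1 / 15` (certificate:
`K_b = 2352273 / 1000000`, `c = 18499 / 250000`, `λ = 117781 / 1000000`, `ρ ≈ 0.9946`); HYPOTHESIS-FREE. [folklore] -/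
theorem su3_torusClusteringOnBallW_star_oneFifth_t100 :
    ∀ κ : ℝ, 1 / 100 ≤ κ → ∀ β : ℝ, 0 ≤ β → β ≤ 1 / 15 →
      TorusClusteringOnBallW 3 4 β κ (17 / 125) (17 / 250) (24 * Real.exp (1 / 50)) (1 / 100) := by
  intro κ hκ
  have e1 : (1 / 5 : ℝ) / ((3 : ℕ) : ℝ) = 1 / 15 := by norm_num
  have e3 : (8 : ℝ) * ((3 : ℕ) : ℝ) = 24 := by norm_num
  have h := suN_torusClusteringOnBallW_star_eigen 20 (N := 3) (by norm_num) (βW := 1 / 5) (κ := κ) (ε₀ := 17 / 125)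
    (ε₁ := 17 / 250) (c := 18499 / 250000) (lam := 117781 / 1000000) (S := 1.73206) (Kb := 2352273 / 1000000)
    (t := 1 / 100) (T₁ := 1010051 / 1000000) (T₂ := 510101 / 500000)
    (by norm_num) (by norm_num) (by norm_num) (by norm_num) hκ exp_le_17_125_w (by rw [show ((3 : ℕ) : ℝ) = 3 by norm_num]; exact sqrt_three_le)
    exp_le_1_100_w (by rw [show (2:ℝ) * (1 / 100) = 1 / 50 by norm_num]; exact exp_le_1_50_w)
    (by norm_num) (by norm_num) (by norm_num) (by norm_num) (by unfold doorPoly; norm_num)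
    (by unfold gaugeR Delta; norm_num)
  have e2 : (2 : ℝ) * (1 / 100) = 1 / 50 := by norm_num
  rw [e1, e2, e3] at h
  exact h

/-- **TIER-2 ROW `(β_W, ε) = (1 / 4, 9 / 500)`, `SU(3)`, `d = 4` torus clustering on the weighted ball `ClusterDomain κ (9 / 250) (9 / 500)`,
WEIGHTED ROBUST STAR DOOR on the eigen modulus**, rate `1/100` per lattice unit, EVERY weight `κ ≥ 1/100`, tree couplings `0 ≤ β ≤ 1 / 12` (certificate:
`K_b = 45 / 16`, `c = 86039 / 1000000`, `λ = 15589 / 500000`, `ρ ≈ 0.9972`); HYPOTHESIS-FREE. [folklore] -/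
theorem su3_torusClusteringOnBallW_star_oneQuarter_t100 :
    ∀ κ : ℝ, 1 / 100 ≤ κ → ∀ β : ℝ, 0 ≤ β → β ≤ 1 / 12 →
      TorusClusteringOnBallW 3 4 β κ (9 / 250) (9 / 500) (24 * Real.exp (1 / 50)) (1 / 100) := by
  intro κ hκ
  have e1 : (1 / 4 : ℝ) / ((3 : ℕ) : ℝ) = 1 / 12 := by norm_num
  have e3 : (8 : ℝ) * ((3 : ℕ) : ℝ) = 24 := by norm_num
  have h := suN_torusClusteringOnBallW_star_eigen 20 (N := 3) (by norm_num) (βW := 1 / 4) (κ := κ) (ε₀ := 9 / 250)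
    (ε₁ := 9 / 500) (c := 86039 / 1000000) (lam := 15589 / 500000) (S := 1.73206) (Kb := 45 / 16)
    (t := 1 / 100) (T₁ := 1010051 / 1000000) (T₂ := 510101 / 500000)
    (by norm_num) (by norm_num) (by norm_num) (by norm_num) hκ exp_le_9_250_w8 (by rw [show ((3 : ℕ) : ℝ) = 3 by norm_num]; exact sqrt_three_le)
    exp_le_1_100_w (by rw [show (2:ℝ) * (1 / 100) = 1 / 50 by norm_num]; exact exp_le_1_50_w)
    (by norm_num) (by norm_num) (by norm_num) (by norm_num) (by unfold doorPoly; norm_num)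
    (by unfold gaugeR Delta; norm_num)
  have e2 : (2 : ℝ) * (1 / 100) = 1 / 50 := by norm_num
  rw [e1, e2, e3] at h
  exact h

/-- **TIER-2 ROW `(β_W, ε) = (1 / 8, 11 / 100)`, `SU(3)`, `d = 4` torus clustering on the weighted ball `ClusterDomain κ (11 / 50) (11 / 100)`,
WEIGHTED ROBUST STAR DOOR on the eigen modulus**, the lineage weight and rate `κ = t = log(6/5)`, tree couplings `0 ≤ β ≤ 1 / 24` (certificate:
`K_b = 9 / 5`, `c = 43023 / 1000000`, `λ = 190527 / 1000000`, `ρ ≈ 0.9927`); HYPOTHESIS-FREE. [folklore] -/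
theorem su3_torusClusteringOnBallW_star_oneEighth_w65 :
    ∀ β : ℝ, 0 ≤ β → β ≤ 1 / 24 →
      TorusClusteringOnBallW 3 4 β (Real.log (6 / 5)) (11 / 50) (11 / 100) (24 * Real.exp (2 * Real.log (6 / 5))) (Real.log (6 / 5)) := by
  have e1 : (1 / 8 : ℝ) / ((3 : ℕ) : ℝ) = 1 / 24 := by norm_num
  have e3 : (8 : ℝ) * ((3 : ℕ) : ℝ) = 24 := by norm_num
  have h := suN_torusClusteringOnBallW_star_eigen 20 (N := 3) (by norm_num) (βW := 1 / 8) (κ := Real.log (6 / 5)) (ε₀ := 11 / 50)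
    (ε₁ := 11 / 100) (c := 43023 / 1000000) (lam := 190527 / 1000000) (S := 1.73206) (Kb := 9 / 5)
    (t := Real.log (6 / 5)) (T₁ := 6 / 5) (T₂ := 36 / 25)
    (by norm_num) (by norm_num) (by norm_num) (Real.log_nonneg (by norm_num)) le_rfl exp_le_11_50_w (by rw [show ((3 : ℕ) : ℝ) = 3 by norm_num]; exact sqrt_three_le)
    (by rw [Real.exp_log (by norm_num)]) (by rw [show (2:ℝ) * Real.log (6 / 5) = Real.log ((6 / 5) ^ 2) by rw [Real.log_pow]; norm_num, Real.exp_log (by norm_num)]; norm_num)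
    (by norm_num) (by norm_num) (by norm_num) (by norm_num) (by unfold doorPoly; norm_num)
    (by unfold gaugeR Delta; norm_num)
  rw [e1, e3] at h
  exact h

/-- **TIER-2 ROW `(β_W, ε) = (1 / 4, 13 / 125)`, `SU(3)`, `d = 3` Y4 currency + torus clustering on the weighted ball `ClusterDomain κ (26 / 125) (13 / 125)`,
WEIGHTED ROBUST STAR DOOR on the eigen modulus**, rate `1/100` per lattice unit, EVERY weight `κ ≥ 1/100`, tree couplings `0 ≤ β ≤ 1 / 12` (certificate:
`K_b = 1044643 / 500000`, `c = 48599 / 500000`, `λ = 36027 / 200000`, `ρ ≈ 0.9918`); HYPOTHESIS-FREE. [folklore] -/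
theorem su3_clusterDomainClusteringW_dim3_star_oneQuarter_t100 :
    ∀ κ : ℝ, 1 / 100 ≤ κ → YM3IR.ClusterDomainClustering (G := SUN 3)
          ⟨fundamentalRep (Fin 3), 1 / 12, fun _ _ W => W ∈ ClusterDomain κ (26 / 125) (13 / 125)⟩ suFrobDist
          (1 / 100) ∧
        ∀ β : ℝ, 0 ≤ β → β ≤ 1 / 12 →
          TorusClusteringOnBallW 3 3 β κ (26 / 125) (13 / 125) (24 * Real.exp (1 / 50)) (1 / 100) := by
  intro κ hκ
  have e1 : (1 / 4 : ℝ) / ((3 : ℕ) : ℝ) = 1 / 12 := by norm_num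
  have e3 : (8 : ℝ) * ((3 : ℕ) : ℝ) = 24 := by norm_num
  have h := suN_clusterDomainClusteringW_dim3_star_eigen 20 (N := 3) (by norm_num) (βW := 1 / 4) (κ := κ) (ε₀ := 26 / 125)
    (ε₁ := 13 / 125) (c := 48599 / 500000) (lam := 36027 / 200000) (S := 1.73206) (Kb := 1044643 / 500000)
    (t := 1 / 100) (T₁ := 1010051 / 1000000) (T₂ := 510101 / 500000)
    (by norm_num) (by norm_num) (by norm_num) (by norm_num) hκ exp_le_26_125_star3 (by rw [show ((3 : ℕ) : ℝ) = 3 by norm_num]; exact sqrt_three_le)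
    exp_le_1_100_w (by rw [show (2:ℝ) * (1 / 100) = 1 / 50 by norm_num]; exact exp_le_1_50_w)
    (by norm_num) (by norm_num) (by norm_num) (by norm_num) (by unfold doorPoly; norm_num)
    (by unfold gaugeR Delta; norm_num)
  have e2 : (2 : ℝ) * (1 / 100) = 1 / 50 := by norm_num
  rw [e1, e2, e3] at h
  exact h

/-- **TIER-2 ROW `(β_W, ε) = (1 / 3, 49 / 1000)`, `SU(3)`, `d = 3` Y4 currency + torus clustering on the weighted ball `ClusterDomain κ (49 / 500) (49 / 1000)`,
WEIGHTED ROBUST STAR DOOR on the eigen modulus**, rate `1/100` per lattice unit, EVERY weight `κ ≥ 1/100`, tree couplings `0 ≤ β ≤ 1 / 9` (certificate: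
`K_b = 2546053 / 1000000`, `c = 60831 / 500000`, `λ = 84871 / 1000000`, `ρ ≈ 0.9946`); HYPOTHESIS-FREE. [folklore] -/
theorem su3_clusterDomainClusteringW_dim3_star_oneThird_t100 :
    ∀ κ : ℝ, 1 / 100 ≤ κ → YM3IR.ClusterDomainClustering (G := SUN 3)
          ⟨fundamentalRep (Fin 3), 1 / 9, fun _ _ W => W ∈ ClusterDomain κ (49 / 500) (49 / 1000)⟩ suFrobDist
          (1 / 100) ∧
        ∀ β : ℝ, 0 ≤ β → β ≤ 1 / 9 →
          TorusClusteringOnBallW 3 3 β κ (49 / 500) (49 / 1000) (24 * Real.exp (1 / 50)) (1 / 100) := by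
  intro κ hκ
  have e1 : (1 / 3 : ℝ) / ((3 : ℕ) : ℝ) = 1 / 9 := by norm_num
  have e3 : (8 : ℝ) * ((3 : ℕ) : ℝ) = 24 := by norm_num
  have h := suN_clusterDomainClusteringW_dim3_star_eigen 20 (N := 3) (by norm_num) (βW := 1 / 3) (κ := κ) (ε₀ := 49 / 500)
    (ε₁ := 49 / 1000) (c := 60831 / 500000) (lam := 84871 / 1000000) (S := 1.73206) (Kb := 2546053 / 1000000)
    (t := 1 / 100) (T₁ := 1010051 / 1000000) (T₂ := 510101 / 500000)
    (by norm_num) (by norm_num) (by norm_num) (by norm_num) hκ exp_098_le (by rw [show ((3 : ℕ) : ℝ) = 3 by norm_num]; exact sqrt_three_le)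
    exp_le_1_100_w (by rw [show (2:ℝ) * (1 / 100) = 1 / 50 by norm_num]; exact exp_le_1_50_w)
    (by norm_num) (by norm_num) (by norm_num) (by norm_num) (by unfold doorPoly; norm_num)
    (by unfold gaugeR Delta; norm_num)
  have e2 : (2 : ℝ) * (1 / 100) = 1 / 50 := by norm_num
  rw [e1, e2, e3] at h
  exact h

/-- **TIER-2 ROW `(β_W, ε) = (3 / 10, 49 / 1000)`, `SU(3)`, `d = 3` Y4 currency + torus clustering on the weighted ball `ClusterDomain κ (49 / 500) (49 / 1000)`,
WEIGHTED ROBUST STAR DOOR on the eigen modulus**, the lineage weight and rate `κ = t = log(6/5)`, tree couplings `0 ≤ β ≤ 1 / 10` (certificate: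
`K_b = 2352273 / 1000000`, `c = 101163 / 1000000`, `λ = 84871 / 1000000`, `ρ ≈ 0.9939`); HYPOTHESIS-FREE. [folklore] -/
theorem su3_clusterDomainClusteringW_dim3_star_threeTenths_w65 :
    YM3IR.ClusterDomainClustering (G := SUN 3)
          ⟨fundamentalRep (Fin 3), 1 / 10, fun _ _ W => W ∈ ClusterDomain (Real.log (6 / 5)) (49 / 500) (49 / 1000)⟩ suFrobDist
          (Real.log (6 / 5)) ∧
        ∀ β : ℝ, 0 ≤ β → β ≤ 1 / 10 →
          TorusClusteringOnBallW 3 3 β (Real.log (6 / 5)) (49 / 500) (49 / 1000) (24 * Real.exp (2 * Real.log (6 / 5))) (Real.log (6 / 5)) := by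
  have e1 : (3 / 10 : ℝ) / ((3 : ℕ) : ℝ) = 1 / 10 := by norm_num
  have e3 : (8 : ℝ) * ((3 : ℕ) : ℝ) = 24 := by norm_num
  have h := suN_clusterDomainClusteringW_dim3_star_eigen 20 (N := 3) (by norm_num) (βW := 3 / 10) (κ := Real.log (6 / 5)) (ε₀ := 49 / 500)
    (ε₁ := 49 / 1000) (c := 101163 / 1000000) (lam := 84871 / 1000000) (S := 1.73206) (Kb := 2352273 / 1000000)
    (t := Real.log (6 / 5)) (T₁ := 6 / 5) (T₂ := 36 / 25)
    (by norm_num) (by norm_num) (by norm_num) (Real.log_nonneg (by norm_num)) le_rfl exp_098_le (by rw [show ((3 : ℕ) : ℝ) = 3 by norm_num]; exact sqrt_three_le)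
    (by rw [Real.exp_log (by norm_num)]) (by rw [show (2:ℝ) * Real.log (6 / 5) = Real.log ((6 / 5) ^ 2) by rw [Real.log_pow]; norm_num, Real.exp_log (by norm_num)]; norm_num)
    (by norm_num) (by norm_num) (by norm_num) (by norm_num) (by unfold doorPoly; norm_num)
    (by unfold gaugeR Delta; norm_num)
  rw [e1, e3] at h
  exact h

end Summit.Ventures.YMGap.RobustBall

end
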